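import Literature.Probability.Percolation.KestenScaling
import Mathlib.Analysis.SpecialFunctions.Pow.Real
import HarnessLib

/-!
# `γ = 43/18` from `χ^f(p) = L_ε(p)^{43/24 + o(1)}` and `ν = 4/3` (assembly, power-bound form)

Topic `Literature/Probability/Percolation`; family `crit-perc`, statement **crit-perc.S16**, named fact
`Literature.Probability.Percolation.triMeanClusterSize_exponent` (`χ^f(p) = |p - 1/2|^{-43/18 + o(1)}` as
`p → 1/2`; Smirnov–Werner 2001, §2, Thm. 1 (ii); Nolin 2008, §7.5). Proofs only (no definition, no
named fact). Companion of `MeanClusterSizeScaling.lean` (which assembles the exponent from the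
two-sided bound `χ^f ≍ L² π₁(L)²` of Nolin's Prop. 43): here the percolation input is taken in the
weaker, logarithmic form that the tree's bricks deliver
(`MeanClusterSizeUpperBound.triMeanClusterSize_le_rpow_at` and its lower-bound counterpart),

* (lower) for every `η > 0`: `χ^f(p) ≥ c_η L_ε(p)^{43/24 - η}` for `p ≠ 1/2` close to `1/2` with
  `L_ε(p)` large;
* (upper) for every `η > 0`: `χ^f(p) ≤ C_η L_ε(p)^{43/24 + η}` likewise;

i.e. `log χ^f(p) / log L_ε(p) → 43/24 = 2 - 2 · (5/48)` — the middle expression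
`L(p)² [L(p)^{-5/48}]²` of Nolin's display after Prop. 43 (arXiv 0711.4948, §7.5):
`χ(p) ≈ L(p)² [L(p)^{-5/48}]² ≈ [|p - 1/2|^{-4/3}]^{86/48} ≈ |p - 1/2|^{-43/18}`. Together with
`ν = 4/3` for `L_ε` (`KestenScaling.tendsto_log_charLength_div_log_at`, from `fourArm_exponent` and
Kesten's relation `Nolin2008_prop34` at `ε`) this gives `log χ^f(p) / log |p - 1/2| → (43/24)(-4/3) =
-43/18` (`tendsto_log_triMeanClusterSize_div_log_of_powerBounds`) and hence
`triMeanClusterSize_exponent` (`triMeanClusterSize_exponent_of_powerBounds`).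

## References

* S. Smirnov, W. Werner, Critical exponents for two-dimensional percolation, *Math. Res. Lett.* 8
  (2001), §2, Thm. 1 (ii) of arXiv:math/0109120 [SmirnovWernerMRL2001].
* P. Nolin, Near-critical percolation in two dimensions, *Electron. J. Probab.* 13 (2008), §7.5,
  Prop. 43 and the display after it (arXiv 0711.4948 numbering) [Nolin2008].
* H. Kesten, Scaling relations for 2D-percolation, *Comm. Math. Phys.* 109 (1987) [KestenScalingCMP1987].

## Mathlib / tree

Only real analysis (`Real.log`, `Real.rpow`, `Filter.Tendsto`, `tendsto_order`, `ENNReal.toReal`).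
Tree: `tendsto_charLength_atTop_at`, `tendsto_log_charLength_div_log_at`, `eventually_nhdsNE_half`
(`KestenScaling.lean`).
-/

noncomputable section

open Filter Topology MeasureTheory Set
open scoped unitInterval ENNReal

namespace Literature.Probability.Percolation

open LatticeModels

/-- **`log χ^f(p) / log |p - 1/2| → -43/18`** from `ν = 4/3` (four-arm exponent and Kesten's relation
at `ε`) and the power bounds `c_η L_ε^{43/24 - η} ≤ χ^f ≤ C_η L_ε^{43/24 + η}` (every `η > 0`, for
`p ≠ 1/2` near `1/2` with `L_ε(p)` large). Proof: the bounds give `log χ^f(p) / log L_ε(p) → 43/24`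
(order characterisation of the limit), and `log L_ε(p) / log |p - 1/2| → -4/3`. [cite: Nolin2008, §7.5, display after Prop. 43 (arXiv 0711.4948 numbering)] [cite: SmirnovWernerMRL2001, §2, Thm. 1 (ii) (arXiv:math/0109120)] -/
theorem tendsto_log_triMeanClusterSize_div_log_of_powerBounds {ε : ℝ} (h₄ : fourArm_exponent)
    (hK : ∃ r₁ : ℕ, ∀ r₀ ≥ r₁, ∃ δ > (0 : ℝ), ∃ c > (0 : ℝ), ∃ C : ℝ,
      ∀ p : unitInterval, (p : ℝ) ≠ 1 / 2 → |(p : ℝ) - 1 / 2| < δ →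
        c ≤ |(p : ℝ) - 1 / 2| * (charLength ε p : ℝ) ^ 2 * critFourArmProb r₀ (charLength ε p) ∧
          |(p : ℝ) - 1 / 2| * (charLength ε p : ℝ) ^ 2 * critFourArmProb r₀ (charLength ε p) ≤ C)
    (hlow : ∀ η : ℝ, 0 < η → ∃ δ > (0 : ℝ), ∃ L₀ : ℕ, ∃ c > (0 : ℝ), ∀ p : unitInterval,
      (p : ℝ) ≠ 1 / 2 → |(p : ℝ) - 1 / 2| < δ → L₀ ≤ charLength ε p →
        ENNReal.ofReal (c * (charLength ε p : ℝ) ^ ((43 : ℝ) / 24 - η)) ≤ triMeanClusterSize p)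
    (hup : ∀ η : ℝ, 0 < η → ∃ δ > (0 : ℝ), ∃ L₀ : ℕ, ∃ C : ℝ, ∀ p : unitInterval,
      (p : ℝ) ≠ 1 / 2 → |(p : ℝ) - 1 / 2| < δ → L₀ ≤ charLength ε p →
        triMeanClusterSize p ≤ ENNReal.ofReal (C * (charLength ε p : ℝ) ^ ((43 : ℝ) / 24 + η))) :
    Tendsto (fun p : ℝ => Real.log (triMeanClusterSizeReal p).toReal / Real.log |p - 1 / 2|)
      (𝓝[≠] (1 / 2)) (𝓝 (-(43 / 18))) := by
  set l : Filter ℝ := 𝓝[≠] (1 / 2) with hl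
  set L : ℝ → ℕ := fun p => charLength ε (projIcc (0 : ℝ) 1 zero_le_one p) with hL
  set χR : ℝ → ℝ := fun p => (triMeanClusterSizeReal p).toReal with hχR
  have hLnat : Tendsto L l atTop := tendsto_charLength_atTop_at hK
  have hLreal : Tendsto (fun p => (L p : ℝ)) l atTop := tendsto_natCast_atTop_iff.2 hLnat
  have hlogL : Tendsto (fun p => Real.log (L p : ℝ)) l atTop := Real.tendsto_log_atTop.comp hLreal
  have hν : Tendsto (fun p => Real.log (L p : ℝ) / Real.log |p - 1 / 2|) l (𝓝 (-(4 / 3))) :=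
    tendsto_log_charLength_div_log_at h₄ hK
  have hχdef : ∀ p : ℝ, triMeanClusterSizeReal p = triMeanClusterSize (projIcc (0 : ℝ) 1 zero_le_one p) :=
    fun _ => rfl
  -- transfer of the two bounds to the filter `l`
  have hlow' : ∀ η : ℝ, 0 < η → ∃ c > (0 : ℝ), ∀ᶠ p in l,
      ENNReal.ofReal (c * (L p : ℝ) ^ ((43 : ℝ) / 24 - η)) ≤ triMeanClusterSizeReal p := by
    intro η hη
    obtain ⟨δ, hδ, L₀, c, hc, h⟩ := hlow η hη
    refine ⟨c, hc, ?_⟩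
    filter_upwards [eventually_nhdsNE_half hδ, hLnat.eventually_ge_atTop L₀] with p ⟨_, hne, hlt, hval⟩ hL₀
    rw [hχdef]
    exact h _ (by rwa [hval]) (by rwa [hval]) hL₀
  have hup' : ∀ η : ℝ, 0 < η → ∃ C : ℝ, ∀ᶠ p in l,
      triMeanClusterSizeReal p ≤ ENNReal.ofReal (C * (L p : ℝ) ^ ((43 : ℝ) / 24 + η)) := by
    intro η hη
    obtain ⟨δ, hδ, L₀, C, h⟩ := hup η hη
    refine ⟨C, ?_⟩
    filter_upwards [eventually_nhdsNE_half hδ, hLnat.eventually_ge_atTop L₀] with p ⟨_, hne, hlt, hval⟩ hL₀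
    rw [hχdef]
    exact h _ (by rwa [hval]) (by rwa [hval]) hL₀
  -- finiteness and positivity of `χ^f` along `l`
  have hfin : ∀ᶠ p in l, triMeanClusterSizeReal p ≠ ∞ := by
    obtain ⟨C, hC⟩ := hup' 1 one_pos
    filter_upwards [hC] with p hp
    exact ne_top_of_le_ne_top ENNReal.ofReal_ne_top hp
  have hL1 : ∀ᶠ p in l, (1 : ℝ) < L p := hLreal.eventually_gt_atTop 1
  -- lower bound on `log χ^f / log L`
  have hg_low : ∀ b : ℝ, b < 43 / 24 → ∀ᶠ p in l, b < Real.log (χR p) / Real.log (L p : ℝ) := by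
    intro b hb
    set η : ℝ := (43 / 24 - b) / 2 with hη
    have hη0 : 0 < η := by rw [hη]; linarith
    obtain ⟨c, hc, hcev⟩ := hlow' η hη0
    have hlogc : ∀ᶠ p in l, -η < Real.log c / Real.log (L p : ℝ) :=
      (tendsto_const_nhds.div_atTop hlogL).eventually (lt_mem_nhds (by linarith))
    filter_upwards [hcev, hfin, hL1, hlogc] with p hcle hfinp hL1p hlogcp
    have hL0 : (0 : ℝ) < L p := by linarith
    have hlogL0 : 0 < Real.log (L p : ℝ) := Real.log_pos hL1p
    have hX : 0 < c * (L p : ℝ) ^ ((43 : ℝ) / 24 - η) := by positivity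
    have hχle : c * (L p : ℝ) ^ ((43 : ℝ) / 24 - η) ≤ χR p :=
      (ENNReal.ofReal_le_iff_le_toReal hfinp).1 hcle
    have hχpos : 0 < χR p := hX.trans_le hχle
    have hlog : Real.log c + ((43 : ℝ) / 24 - η) * Real.log (L p : ℝ) ≤ Real.log (χR p) := by
      rw [← Real.log_rpow hL0, ← Real.log_mul hc.ne' (Real.rpow_pos_of_pos hL0 _).ne']
      exact Real.log_le_log hX hχle
    rw [lt_div_iff₀ hlogL0]
    have h1 : -η * Real.log (L p : ℝ) < Real.log c := by
      rwa [lt_div_iff₀ hlogL0] at hlogcp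
    have h2 : b = (43 : ℝ) / 24 - η + -η := by rw [hη]; ring
    rw [h2]
    nlinarith [h1, hlog, hlogL0]
  -- upper bound on `log χ^f / log L`
  have hg_up : ∀ b : ℝ, 43 / 24 < b → ∀ᶠ p in l, Real.log (χR p) / Real.log (L p : ℝ) < b := by
    intro b hb
    set η : ℝ := (b - 43 / 24) / 2 with hη
    have hη0 : 0 < η := by rw [hη]; linarith
    obtain ⟨C, hCev⟩ := hup' η hη0
    obtain ⟨c, hc, hcev⟩ := hlow' 1 one_pos
    have hlogC : ∀ᶠ p in l, Real.log C / Real.log (L p : ℝ) < η :=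
      (tendsto_const_nhds.div_atTop hlogL).eventually (gt_mem_nhds hη0)
    filter_upwards [hCev, hcev, hfin, hL1, hlogC] with p hCle hcle hfinp hL1p hlogCp
    have hL0 : (0 : ℝ) < L p := by linarith
    have hlogL0 : 0 < Real.log (L p : ℝ) := Real.log_pos hL1p
    -- positivity of `χ^f` from the lower bound at `η = 1`
    have hχpos : 0 < χR p := by
      have hX : 0 < c * (L p : ℝ) ^ ((43 : ℝ) / 24 - 1) := by positivity
      exact hX.trans_le ((ENNReal.ofReal_le_iff_le_toReal hfinp).1 hcle)
    -- the upper constant is positive and the bound transfers to `toReal`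
    set X : ℝ := (L p : ℝ) ^ ((43 : ℝ) / 24 + η) with hXdef
    have hXpos : 0 < X := Real.rpow_pos_of_pos hL0 _
    have hχle : χR p ≤ max (C * X) 0 := by
      have := ENNReal.toReal_mono ENNReal.ofReal_ne_top hCle
      rwa [ENNReal.toReal_ofReal'] at this
    have hCX : 0 < C * X := by
      by_contra hCX
      push Not at hCX
      rw [max_eq_right hCX] at hχle
      exact absurd hχle (not_le.2 hχpos)
    have hCpos : 0 < C := pos_of_mul_pos_left hCX hXpos.le
    rw [max_eq_left hCX.le] at hχle
    have hlog : Real.log (χR p) ≤ Real.log C + ((43 : ℝ) / 24 + η) * Real.log (L p : ℝ) := by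
      rw [← Real.log_rpow hL0, ← Real.log_mul hCpos.ne' hXpos.ne']
      exact Real.log_le_log hχpos hχle
    rw [div_lt_iff₀ hlogL0]
    have h1 : Real.log C < η * Real.log (L p : ℝ) := by
      rwa [div_lt_iff₀ hlogL0] at hlogCp
    have h2 : b = (43 : ℝ) / 24 + η + η := by rw [hη]; ring
    rw [h2]
    nlinarith [h1, hlog, hlogL0]
  have hg : Tendsto (fun p => Real.log (χR p) / Real.log (L p : ℝ)) l (𝓝 (43 / 24)) :=
    tendsto_order.2 ⟨hg_low, hg_up⟩
  -- conclude: `log χ / log |p - 1/2| = (log χ / log L) · (log L / log |p - 1/2|)`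
  have h := hg.mul hν
  have hlim : (43 / 24 : ℝ) * -(4 / 3) = -(43 / 18) := by norm_num
  rw [hlim] at h
  refine h.congr' ?_
  filter_upwards [hL1] with p hL1p
  have hlogL0 : Real.log (L p : ℝ) ≠ 0 := (Real.log_pos hL1p).ne'
  rw [div_mul_div_cancel₀ hlogL0]

/-- **Assembly of crit-perc.S16 (`γ = 43/18`), power-bound form**: the four-arm exponent, Kesten's
relation at `ε` and the bounds `c_η L_ε^{43/24 - η} ≤ χ^f ≤ C_η L_ε^{43/24 + η}` (every `η > 0`,
near `p = 1/2`, `L_ε` large) imply `triMeanClusterSize_exponent`. [cite: SmirnovWernerMRL2001, §2, Thm. 1 (ii) (arXiv:math/0109120)] [cite: Nolin2008, §7.5, Prop. 43 and the display after it (arXiv 0711.4948 numbering)] -/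
theorem triMeanClusterSize_exponent_of_powerBounds {ε : ℝ} (h₄ : fourArm_exponent)
    (hK : ∃ r₁ : ℕ, ∀ r₀ ≥ r₁, ∃ δ > (0 : ℝ), ∃ c > (0 : ℝ), ∃ C : ℝ,
      ∀ p : unitInterval, (p : ℝ) ≠ 1 / 2 → |(p : ℝ) - 1 / 2| < δ →
        c ≤ |(p : ℝ) - 1 / 2| * (charLength ε p : ℝ) ^ 2 * critFourArmProb r₀ (charLength ε p) ∧
          |(p : ℝ) - 1 / 2| * (charLength ε p : ℝ) ^ 2 * critFourArmProb r₀ (charLength ε p) ≤ C)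
    (hlow : ∀ η : ℝ, 0 < η → ∃ δ > (0 : ℝ), ∃ L₀ : ℕ, ∃ c > (0 : ℝ), ∀ p : unitInterval,
      (p : ℝ) ≠ 1 / 2 → |(p : ℝ) - 1 / 2| < δ → L₀ ≤ charLength ε p →
        ENNReal.ofReal (c * (charLength ε p : ℝ) ^ ((43 : ℝ) / 24 - η)) ≤ triMeanClusterSize p)
    (hup : ∀ η : ℝ, 0 < η → ∃ δ > (0 : ℝ), ∃ L₀ : ℕ, ∃ C : ℝ, ∀ p : unitInterval,
      (p : ℝ) ≠ 1 / 2 → |(p : ℝ) - 1 / 2| < δ → L₀ ≤ charLength ε p →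
        triMeanClusterSize p ≤ ENNReal.ofReal (C * (charLength ε p : ℝ) ^ ((43 : ℝ) / 24 + η))) :
    triMeanClusterSize_exponent := by
  have h := tendsto_log_triMeanClusterSize_div_log_of_powerBounds h₄ hK hlow hup
  rw [show (-(43 / 18) : ℝ) = -43 / 18 by norm_num] at h
  constructor
  · have h' := h.mono_left (nhdsWithin_mono (1 / 2 : ℝ) (fun p (hp : 1 / 2 < p) => ne_of_gt hp))
    refine h'.congr' (Eventually.of_forall fun p => ?_)
    simp only [Real.log_abs]
  · have h' := h.mono_left (nhdsWithin_mono (1 / 2 : ℝ) (fun p (hp : p < 1 / 2) => ne_of_lt hp))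
    refine h'.congr' (Eventually.of_forall fun p => ?_)
    simp only
    rw [← Real.log_abs (1 / 2 - p), abs_sub_comm]

/-- **The lower power bound from `χ^f ≥ c L_ε² π₁(L_ε)²` and the one-arm exponent**: if
`c L_ε(p)² π₁(L_ε(p))² ≤ χ^f(p)` for `p ≠ 1/2` near `1/2` (Nolin 2008, Lemma 42, lower bound) and
`π₁(m) = m^{-5/48 + o(1)}` (`oneArm_exponent`), then for every `η > 0`,
`χ^f(p) ≥ c L_ε(p)^{43/24 - η}` for `p ≠ 1/2` near `1/2` with `L_ε(p)` large
(`π₁(L) ≥ L^{-5/48 - η/2}` for large `L`). [cite: Nolin2008, §7.5, Lemma 42 (lower bound) and the display after Prop. 43 (arXiv 0711.4948 numbering)] -/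
theorem triMeanClusterSize_powerLowerBound_of_sq {ε : ℝ} (h₁ : oneArm_exponent)
    (hlow : ∃ δ > (0 : ℝ), ∃ c > (0 : ℝ), ∀ p : unitInterval, (p : ℝ) ≠ 1 / 2 → |(p : ℝ) - 1 / 2| < δ →
      ENNReal.ofReal (c * ((charLength ε p : ℝ) ^ 2 * critOneArmProb (charLength ε p) ^ 2)) ≤
        triMeanClusterSize p) :
    ∀ η : ℝ, 0 < η → ∃ δ > (0 : ℝ), ∃ L₀ : ℕ, ∃ c > (0 : ℝ), ∀ p : unitInterval,
      (p : ℝ) ≠ 1 / 2 → |(p : ℝ) - 1 / 2| < δ → L₀ ≤ charLength ε p →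
        ENNReal.ofReal (c * (charLength ε p : ℝ) ^ ((43 : ℝ) / 24 - η)) ≤ triMeanClusterSize p := by
  intro η hη
  obtain ⟨δ, hδ, c, hc, h⟩ := hlow
  -- `π₁(m) ≥ m^{-5/48 - η/2}` for large `m`
  have hπ : HasDecayExponent critOneArmProb (5 / 48) := h₁
  have hev : ∀ᶠ m : ℕ in atTop, -(5 / 48) - η / 2 < Real.log (critOneArmProb m) / Real.log m :=
    hπ.eventually (lt_mem_nhds (by linarith))
  have hpos : ∀ᶠ m : ℕ in atTop, 0 < critOneArmProb m :=
    hasDecayExponent_eventually_pos hπ (by norm_num) (fun _ => measureReal_nonneg)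
  obtain ⟨M₀, hM₀⟩ := eventually_atTop.1 (hev.and (hpos.and (eventually_ge_atTop 2)))
  refine ⟨δ, hδ, M₀, c, hc, fun p hp hpδ hL => ?_⟩
  obtain ⟨hlt, hπpos, hm2⟩ := hM₀ _ hL
  set L := charLength ε p with hLdef
  have hL1 : (1 : ℝ) < L := by exact_mod_cast (show 1 < L by omega)
  have hL0 : (0 : ℝ) < L := by linarith
  have hlogL : 0 < Real.log L := Real.log_pos hL1
  -- `L^{-5/48 - η/2} ≤ π₁(L)`
  have hπL : (L : ℝ) ^ (-(5 / 48 : ℝ) - η / 2) ≤ critOneArmProb L := by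
    rw [lt_div_iff₀ hlogL] at hlt
    rw [Real.rpow_def_of_pos hL0, ← Real.exp_log hπpos]
    exact Real.exp_le_exp.2 (by linarith [mul_comm (Real.log L) (-(5 / 48 : ℝ) - η / 2)])
  refine le_trans (ENNReal.ofReal_le_ofReal ?_) (h p hp hpδ)
  refine mul_le_mul_of_nonneg_left ?_ hc.le
  have hsq : ((L : ℝ) ^ (-(5 / 48 : ℝ) - η / 2)) ^ 2 ≤ critOneArmProb L ^ 2 :=
    pow_le_pow_left₀ (Real.rpow_nonneg hL0.le _) hπL 2
  calc (L : ℝ) ^ ((43 : ℝ) / 24 - η) = (L : ℝ) ^ 2 * ((L : ℝ) ^ (-(5 / 48 : ℝ) - η / 2)) ^ 2 := by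
        rw [sq ((L : ℝ) ^ _), ← Real.rpow_add hL0, ← Real.rpow_two, ← Real.rpow_add hL0]
        congr 1; ring
    _ ≤ (L : ℝ) ^ 2 * critOneArmProb L ^ 2 := mul_le_mul_of_nonneg_left hsq (by positivity)

end Literature.Probability.Percolation
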